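import Mathlib
import HarnessLib.Audit
import Summits.PneNP.PneNP.Theorems.PstarGateCaseTCycle
import Summits.PneNP.PneNP.Theorems.PstarPathRankFibre
import Summits.PneNP.PneNP.Theorems.PstarChordBridgeForcing
import Summits.PneNP.PneNP.Theorems.PstarGateUnit
import Summits.PneNP.PneNP.Theorems.PstarNorUnitBridge
import Summits.PneNP.PneNP.Theorems.PstarNorCoreTools

/-!
# One GATED chord: if `Q_{D e}` loses rank on the gate chamber, the gated chord closes a TRIANGLE through a `u`-edge (E2 rank-2 exception; prover-1 g18)

FRONTIER range-avoidance ladder, rung F-N3 (`stmt-PneNP-19007`), cell `pnp-ideate` (this seat's `HOME/pnp-ideate-prover-1/g18/E2-PLAN.md` §2 B3,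
§5; memo `r24/CORE-BOUND-NOTES.md` §10.1); restricted-model proof complexity — nothing here bears on `P` versus `NP`.

Every fibre statement of the E2 chain (`caseT_fibre_dichotomy`, `fibre_dichotomy_of_sep`, …) assumes rank `≥ 4` of `Q_{D e}` restricted to the gate
chamber `coordKer {u}`.  This file settles the EXCEPTION: by `PstarPathRankFibre.rank_four_on_fibre` (contrapositive) the part of `D e` avoiding `u` is
empty, a STAR (one AND variable `d` common to all its edges), or totally shared; the edges of `D e` through `u` form an XOR-matching
(`PstarGateCaseTCycle.matching_of_through`, `avoid_nonempty`); and the gate `g₀ = (p, u)` PAYS (`PstarGateUnit.false_of_tight_payer`: its AND variables `p`, `u` both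
occur in the cycle `D e + e`, `p` as a boundary variable).  Boundary accounting on the cycle (XOR slots never boundary; a literal used twice never
boundary) then leaves only:

* `card_eq_two_of_not_rank_four` — **`#D e = 2`**, with one edge of `D e` through `u`: the gated chord `e` closes a TRIANGLE `{j_u, j_d, e}`, exactly as
  in the PIN + GATE unit and in the `k = 5` census hits (where `u = σ` is shared by two cotree edges).  Hypotheses: pure typed `(r,3/2)`-expanding
  instance with simple overlaps, well-formed bridge data with `#J₀ ≤ r`, `e ∈ N`, a gate output `g₀ ∉ J₀` with AND pair `{vars e 2, u}`,
  `#(D e + e + g₀) ≤ r`, and NOT rank `≥ 4` on the chamber.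
-/

set_option linter.dupNamespace false -- `Summit.PneNP.PneNP.…`: summit = sub-problem name (D-0017 single-conjunct layout)

open Finset Module Literature.Computability.Complexity
open Summit.PneNP.PneNP.Theorems.PstarTyped (Typed)
open Summit.PneNP.PneNP.Theorems.PstarSALevel (varSet bdry BoundaryExpanding SimpleOverlap)
open Summit.PneNP.PneNP.Theorems.PstarGapLinearised (andPair andPair_subset_varSet)
open Summit.PneNP.PneNP.Theorems.PstarGapPeeling (not_mem_varSet_of_private)
open Summit.PneNP.PneNP.Theorems.PstarCentreFree (vars_mem_varSet)
open Summit.PneNP.PneNP.Theorems.PstarXCore (xpair xverts mem_xpair)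
open Summit.PneNP.PneNP.Theorems.PstarProductRank (qform polar)
open Summit.PneNP.PneNP.Theorems.PstarQuadRank (rad)
open Summit.PneNP.PneNP.Theorems.PstarPathRankFibre (coordKer avoid rank_restrict_ge rank_four_of_not_star_not_shared)
open Summit.PneNP.PneNP.Theorems.PstarChordBridgeTools (privs xpdeg)
open Summit.PneNP.PneNP.Theorems.PstarChordBridge (BridgeData)
open Summit.PneNP.PneNP.Theorems.PstarChordBridgeFundamental (odd_of_end two_le_card_of_even exists_mem_of_odd xpdeg_insert)
open Summit.PneNP.PneNP.Theorems.PstarChordBridgeForcing (rank_four_of_wf)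
open Summit.PneNP.PneNP.Theorems.PstarGateUnit (mem_bdry_of_unique false_of_tight_payer)
open Summit.PneNP.PneNP.Theorems.PstarNorUnitBridge (xor_not_mem_bdry_of_even)
open Summit.PneNP.PneNP.Theorems.PstarNorCoreTools (not_mem_bdry_of_two card_varSet_inter_bdry_le card_bdry_le_sum)
open Summit.PneNP.PneNP.Theorems.PstarGateCaseTCycle (matching_of_through)

namespace Summit.PneNP.PneNP.Theorems.PstarGateFibreRank

variable {n m : ℕ}

/-- `D` splits into the edges through `u` and the edges avoiding `u`. -/
theorem card_through_add_card_avoid (I : LocalMap 4 n m) (D : Finset (Fin m)) (u : Fin n) :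
    (D.filter fun j => I.vars j 2 = u ∨ I.vars j 3 = u).card + (avoid I D {u}).card = D.card := by
  classical
  unfold PstarPathRankFibre.avoid
  have h : D.filter (fun j => I.vars j 2 ∉ ({u} : Finset (Fin n)) ∧ I.vars j 3 ∉ ({u} : Finset (Fin n))) =
      D.filter (fun j => ¬ (I.vars j 2 = u ∨ I.vars j 3 = u)) := by
    refine filter_congr fun j _ => ?_
    simp only [mem_singleton, not_or]
  rw [h, card_filter_add_card_filter_not]

/-- **A fundamental set is not an XOR-matching**: not every edge of `D` passes through one AND variable `u`. -/
theorem avoid_nonempty (I : LocalMap 4 n m) (hI : I.IsPure xorAndPred) (hS : SimpleOverlap I) {D : Finset (Fin m)} {e : Fin m} (heD : e ∉ D)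
    (heven : ∀ w, Even (xpdeg I (insert e D) w)) (u : Fin n) : (avoid I D {u}).Nonempty := by
  classical
  rw [nonempty_iff_ne_empty]
  intro h0
  have hall : ∀ j ∈ D, I.vars j 2 = u ∨ I.vars j 3 = u := by
    intro j hj
    by_contra hno
    push Not at hno
    have : j ∈ avoid I D {u} := by
      unfold PstarPathRankFibre.avoid
      exact mem_filter.2 ⟨hj, by simpa only [mem_singleton] using hno⟩
    rw [h0] at this
    exact notMem_empty _ this
  -- the `D`-edge `j₁` at the endpoint `a := vars e 0`, and its other endpoint `v₁`
  obtain ⟨j₁, hj₁, hj₁a⟩ := exists_mem_of_odd I (odd_of_end I hI heD heven (s := 0) (by decide))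
  have hj₁01 : I.vars j₁ 0 ≠ I.vars j₁ 1 := fun h => absurd (hI.2 j₁ h) (by decide)
  obtain ⟨v₁, hv₁j, hv₁a⟩ : ∃ v₁ ∈ xpair I j₁, v₁ ≠ I.vars e 0 := by
    rcases (mem_xpair I).1 hj₁a with h | h
    · refine ⟨I.vars j₁ 1, (mem_xpair I).2 (Or.inr rfl), fun h' => hj₁01 ?_⟩; rw [← h'] at h; exact h.symm
    · refine ⟨I.vars j₁ 0, (mem_xpair I).2 (Or.inl rfl), fun h' => hj₁01 ?_⟩; rw [← h'] at h; exact h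
  have hje : j₁ ≠ e := fun h => heD (h ▸ hj₁)
  have hxs : ∀ {i : Fin m} {v : Fin n}, v ∈ xpair I i → v ∈ varSet I i := by
    intro i v hv
    rcases (mem_xpair I).1 hv with rfl | rfl
    · exact vars_mem_varSet I i 0
    · exact vars_mem_varSet I i 1
  -- `v₁` is not the other endpoint of `e` (else `j₁ ∥ e`)
  have hv₁b : v₁ ≠ I.vars e 1 := by
    intro h
    exact PstarChordEndgameTools.not_two_shared I hS hje hv₁a (hxs hv₁j) (by rw [h]; exact vars_mem_varSet I e 1) (hxs hj₁a)
      (vars_mem_varSet I e 0)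
  -- so `v₁` has even degree in `D`, hence a second `D`-edge through `v₁`: not a matching
  have hdeg : Even (xpdeg I D v₁) := by
    have h := heven v₁
    rw [xpdeg_insert I heD, if_neg (Ne.symm hv₁a), if_neg (Ne.symm hv₁b), add_zero, add_zero] at h
    exact h
  have hpos : 0 < xpdeg I D v₁ :=
    (PstarChordBridgeCotree.mem_xverts_iff_xpdeg_pos I D v₁).1 (by unfold PstarXCore.xverts; exact mem_biUnion.2 ⟨j₁, hj₁, hv₁j⟩)
  have h2 : 2 ≤ xpdeg I D v₁ := by
    obtain ⟨k, hk⟩ := hdeg; omega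
  obtain ⟨j₂, hj₂, hne, hv₁j₂⟩ := PstarNorUnitCoverTools.exists_ne_of_two_le_xpdeg I hI j₁ h2
  exact matching_of_through I hI hS hne (hall j₂ hj₂) (hall j₁ hj₁) hv₁j₂ hv₁j

/-- XOR slots of the cycle `D e + e` are never boundary variables of it; a slot holding a variable used by another member neither. -/
theorem card_inter_bdry_le (I : LocalMap 4 n m) (hI : I.IsPure xorAndPred) {X : Finset (Fin m)} (heven : ∀ w, Even (xpdeg I X w))
    {j : Fin m} (hj : j ∈ X) (N : Finset (Fin 4)) (hN : ∀ s ∈ N, 2 ≤ s.val → ∃ j' ∈ X, j' ≠ j ∧ I.vars j s ∈ varSet I j') :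
    (varSet I j ∩ bdry I X).card ≤ 4 - N.card := by
  refine card_varSet_inter_bdry_le I X j N fun s hs => ?_
  by_cases hs2 : s.val < 2
  · exact xor_not_mem_bdry_of_even I hI heven j hj s hs2
  · obtain ⟨j', hj', hne, hv⟩ := hN s hs (by omega)
    exact not_mem_bdry_of_two I hj hj' (Ne.symm hne) (vars_mem_varSet I j s) hv

/-- **Rank deficiency on the gate chamber forces a triangle.**  See the module docstring. -/
theorem card_eq_two_of_not_rank_four (I : LocalMap 4 n m) (hI : I.IsPure xorAndPred) (hS : SimpleOverlap I) {r : ℕ}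
    (hB : BoundaryExpanding r I) {B : BridgeData n m} (hW : B.WF I) (hJr : B.J₀.card ≤ r) {e : Fin m} (he : e ∈ B.N)
    {g₀ : Fin m} (hg₀ : g₀ ∉ B.J₀) {u : Fin n}
    (hgv : (I.vars g₀ 2 = I.vars e 2 ∧ I.vars g₀ 3 = u) ∨ (I.vars g₀ 2 = u ∧ I.vars g₀ 3 = I.vars e 2))
    (hr : (insert g₀ (insert e (B.D e))).card ≤ r)
    (hrank : ¬ finrank (ZMod 2) (rad ((polar (B.D e) (fun j => I.vars j 2) (fun j => I.vars j 3)).restrict (coordKer ({u} : Finset (Fin n)))))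
      + 4 ≤ finrank (ZMod 2) (coordKer ({u} : Finset (Fin n)))) :
    (B.D e).card = 2 ∧ ∃ j ∈ B.D e, I.vars j 2 = u ∨ I.vars j 3 = u := by
  classical
  set D := B.D e with hD
  -- the edges of `D` through `u`
  set T : Finset (Fin m) := D.filter (fun j => I.vars j 2 = u ∨ I.vars j 3 = u) with hT
  have heD : e ∉ D := fun h => (mem_sdiff.1 (hW.hD e he h)).2 he
  have heven : ∀ w, Even (xpdeg I (insert e D) w) := hW.hDeven e he
  have h2D : 2 ≤ D.card := two_le_card_of_even I hI hS heD heven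
  set X : Finset (Fin m) := insert e D with hX
  have heX : e ∈ X := mem_insert_self _ _
  have hDX : ∀ {j}, j ∈ D → j ∈ X := fun hj => mem_insert_of_mem hj
  have hDJ : D ⊆ B.J₀ := (hW.hD e he).trans sdiff_subset
  have hXJ : X ⊆ B.J₀ := insert_subset (hW.hN he) hDJ
  -- (0) some edge of `D` passes through `u` (else no rank is lost)
  have hrank' := rank_restrict_ge I D ({u} : Finset (Fin n))
  have hsplit : T.card + (avoid I D {u}).card = D.card := by rw [hT]; exact card_through_add_card_avoid I D u
  have hthrough : (T).Nonempty := by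
    rw [nonempty_iff_ne_empty]
    intro h0
    have hav : avoid I D {u} = D := by
      have h := hsplit
      rw [h0, card_empty, zero_add] at h
      exact eq_of_subset_of_card_le (filter_subset _ _) h.ge
    have h4 := rank_four_of_wf I hI hS hB hW hJr he
    rw [← hD, ← hav] at h4
    rw [Module.finrank_pi, Fintype.card_fin] at h4
    exact hrank (by omega)
  obtain ⟨jᵤ, hjᵤ⟩ := hthrough
  obtain ⟨hjᵤD, hjᵤu⟩ := mem_filter.1 hjᵤ
  refine ⟨?_, jᵤ, hjᵤD, hjᵤu⟩
  -- the payer: `g₀ = (p, u)` with `p` boundary of `X`, `u` inside `X`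
  have hp_priv : ∀ j' ∈ X, I.vars e 2 ∈ varSet I j' → j' = e := by
    intro j' hj' hv
    by_contra hne
    exact not_mem_varSet_of_private I (hW.hN he) (hXJ hj') hne (hW.hchord e he).1 (vars_mem_varSet I e 2) hv
  have hpb : I.vars e 2 ∈ bdry I X := mem_bdry_of_unique I heX (vars_mem_varSet I e 2) hp_priv
  have hu_vs : u ∈ varSet I jᵤ := by rcases hjᵤu with h | h <;> rw [← h] <;> exact vars_mem_varSet I jᵤ _
  have hin : ∀ v ∈ andPair I g₀, ∃ j ∈ X, v ∈ varSet I j := by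
    intro v hv
    rcases (PstarChordEndgameTools.mem_andPair_iff I g₀ v).1 hv with rfl | rfl
    · rcases hgv with ⟨h2, -⟩ | ⟨h2, -⟩
      · exact ⟨e, heX, h2 ▸ vars_mem_varSet I e 2⟩
      · exact ⟨jᵤ, hDX hjᵤD, h2 ▸ hu_vs⟩
    · rcases hgv with ⟨-, h3⟩ | ⟨-, h3⟩
      · exact ⟨jᵤ, hDX hjᵤD, h3 ▸ hu_vs⟩
      · exact ⟨e, heX, h3 ▸ vars_mem_varSet I e 2⟩
  have hpg : I.vars e 2 ∈ andPair I g₀ := by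
    rcases hgv with ⟨h2, -⟩ | ⟨-, h3⟩
    · exact (PstarChordEndgameTools.mem_andPair_iff I g₀ _).2 (Or.inl h2.symm)
    · exact (PstarChordEndgameTools.mem_andPair_iff I g₀ _).2 (Or.inr h3.symm)
  have hg₀X : g₀ ∉ X := fun h => hg₀ (hXJ h)
  have hrX : (insert g₀ X).card ≤ r := hr
  -- so `X` is NOT at best tight: `3·#X < 2·#bdry X`
  have hnot_tight : ¬ 2 * (bdry I X).card ≤ 3 * X.card := fun ht => false_of_tight_payer I hB hg₀X hrX ht hin hpg hpb
  have hXcard : X.card = D.card + 1 := card_insert_of_notMem heD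
  -- (1) the three shapes of the `u`-avoiding part
  by_contra hD2
  have h3D : 3 ≤ D.card := by omega
  apply hnot_tight
  -- per-edge boundary budgets
  have havne : (avoid I D {u}).Nonempty := avoid_nonempty I hI hS heD heven u
  have key : ¬ ((avoid I D {u}).Nonempty ∧ (¬ ∃ d : Fin n, ∀ j ∈ avoid I D {u}, d ∈ andPair I j) ∧
      ¬ ∀ j₀ ∈ avoid I D {u}, ∀ s : Fin 4, 2 ≤ s.val → ∃ j ∈ avoid I D {u}, j ≠ j₀ ∧ I.vars j₀ s ∈ andPair I j) := by
    rintro ⟨h1, h2, h3⟩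
    have h := rank_four_of_not_star_not_shared I hI hS h1 h2 h3
    rw [Module.finrank_pi, Fintype.card_fin] at h
    exact hrank (by have := hrank'; omega)
  -- through-u edges: `u` is shared with... at least two members when `#through ≥ 2`; budget `1 + [#through = 1]`
  have hmem_through : ∀ {j}, j ∈ T → j ∈ D ∧ (I.vars j 2 = u ∨ I.vars j 3 = u) := fun hj => mem_filter.1 hj
  have budget_through : ∀ j ∈ T, (varSet I j ∩ bdry I X).card ≤ if (T).card = 1 then 2 else 1 := by
    intro j hj
    obtain ⟨hjD, hju⟩ := hmem_through hj
    split_ifs with h1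
    · have := card_inter_bdry_le I hI heven (hDX hjD) {0, 1} (fun s hs hs2 => by simp at hs; rcases hs with rfl | rfl <;> simp at hs2)
      simpa using this
    · -- a second edge through `u`
      obtain ⟨j', hj', hne⟩ : ∃ j' ∈ T, j' ≠ j := by
        have h2 : 1 < (T).card := by
          have := card_pos.2 ⟨j, hj⟩; omega
        obtain ⟨a, ha, b, hb, hab⟩ := one_lt_card.1 h2
        by_cases haj : a = j
        · exact ⟨b, hb, fun h => hab (haj.trans h.symm)⟩
        · exact ⟨a, ha, haj⟩
      obtain ⟨hj'D, hj'u⟩ := hmem_through hj'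
      have hu' : u ∈ varSet I j' := by rcases hj'u with h | h <;> rw [← h] <;> exact vars_mem_varSet I j' _
      obtain ⟨su, hsu2, hsu⟩ : ∃ s : Fin 4, 2 ≤ s.val ∧ I.vars j s = u := by
        rcases hju with h | h
        · exact ⟨2, by decide, h⟩
        · exact ⟨3, by decide, h⟩
      have := card_inter_bdry_le I hI heven (hDX hjD) {0, 1, su}
        (fun s hs hs2 => by
          simp only [mem_insert, mem_singleton] at hs
          rcases hs with rfl | rfl | rfl
          · simp at hs2
          · simp at hs2
          · exact ⟨j', hDX hj'D, hne, hsu ▸ hu'⟩)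
      have hc : ({0, 1, su} : Finset (Fin 4)).card = 3 := by
        rw [card_insert_of_notMem, card_insert_of_notMem, card_singleton]
        · rw [mem_singleton]; intro h; rw [← h] at hsu2; simp at hsu2
        · simp only [mem_insert, mem_singleton]; push Not
          exact ⟨by decide, fun h => by rw [← h] at hsu2; simp at hsu2⟩
      rw [hc] at this
      simpa using this
  -- the avoiding part: a star around `d`, or totally shared
  have budget_avoid : ∀ j ∈ avoid I D {u}, (varSet I j ∩ bdry I X).card ≤ if (avoid I D {u}).card = 1 then 2 else 1 := by
    intro j hj
    have hjD : j ∈ D := (mem_filter.1 hj).1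
    split_ifs with h1
    · have := card_inter_bdry_le I hI heven (hDX hjD) {0, 1} (fun s hs hs2 => by simp at hs; rcases hs with rfl | rfl <;> simp at hs2)
      simpa using this
    · -- star or shared: some AND slot of `j` is held by another avoiding edge
      obtain ⟨s, hs2, j', hj', hne, hv⟩ : ∃ s : Fin 4, 2 ≤ s.val ∧ ∃ j' ∈ avoid I D {u}, j' ≠ j ∧ I.vars j s ∈ varSet I j' := by
        by_cases hstar : ∃ d : Fin n, ∀ i ∈ avoid I D {u}, d ∈ andPair I i
        · obtain ⟨d, hd⟩ := hstar
          obtain ⟨j', hj', hne⟩ : ∃ j' ∈ avoid I D {u}, j' ≠ j := by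
            have h2 : 1 < (avoid I D {u}).card := by
              have := card_pos.2 ⟨j, hj⟩; omega
            obtain ⟨a, ha, b, hb, hab⟩ := one_lt_card.1 h2
            by_cases haj : a = j
            · exact ⟨b, hb, fun h => hab (haj.trans h.symm)⟩
            · exact ⟨a, ha, haj⟩
          rcases (PstarChordEndgameTools.mem_andPair_iff I j d).1 (hd j hj) with h | h
          · exact ⟨2, by decide, j', hj', hne, h ▸ andPair_subset_varSet I j' (hd j' hj')⟩
          · exact ⟨3, by decide, j', hj', hne, h ▸ andPair_subset_varSet I j' (hd j' hj')⟩
        · have hshared : ∀ j₀ ∈ avoid I D {u}, ∀ s : Fin 4, 2 ≤ s.val → ∃ i ∈ avoid I D {u}, i ≠ j₀ ∧ I.vars j₀ s ∈ andPair I i := by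
            by_contra hns
            exact key ⟨havne, hstar, hns⟩
          obtain ⟨i, hi, hne, hv⟩ := hshared j hj 2 (by decide)
          exact ⟨2, by decide, i, hi, hne, andPair_subset_varSet I i hv⟩
      have := card_inter_bdry_le I hI heven (hDX hjD) {0, 1, s}
        (fun s' hs' hs2' => by
          simp only [mem_insert, mem_singleton] at hs'
          rcases hs' with rfl | rfl | rfl
          · simp at hs2'
          · simp at hs2'
          · exact ⟨j', hDX (mem_filter.1 hj').1, hne, hv⟩)
      have hc : ({0, 1, s} : Finset (Fin 4)).card = 3 := by
        rw [card_insert_of_notMem, card_insert_of_notMem, card_singleton]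
        · rw [mem_singleton]; intro h; rw [← h] at hs2; simp at hs2
        · simp only [mem_insert, mem_singleton]; push Not
          exact ⟨by decide, fun h => by rw [← h] at hs2; simp at hs2⟩
      rw [hc] at this
      simpa using this
  -- `e` itself: budget `2`
  have budget_e : (varSet I e ∩ bdry I X).card ≤ 2 := by
    have := card_inter_bdry_le I hI heven heX {0, 1} (fun s hs hs2 => by simp at hs; rcases hs with rfl | rfl <;> simp at hs2)
    simpa using this
  -- total
  let q : Fin m → ℕ := fun j => if j = e then 2 else if j ∈ T then (if (T).card = 1 then 2 else 1)
    else (if (avoid I D {u}).card = 1 then 2 else 1)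
  have hq : ∀ j ∈ X, (varSet I j ∩ bdry I X).card ≤ q j := by
    intro j hj
    rcases mem_insert.1 hj with rfl | hjD
    · simp only [q, if_true]; exact budget_e
    · have hje : j ≠ e := fun h => heD (h ▸ hjD)
      simp only [q, if_neg hje]
      by_cases hjt : j ∈ T
      · rw [if_pos hjt]; exact budget_through j hjt
      · rw [if_neg hjt]
        have hja : j ∈ avoid I D {u} := by
          unfold PstarPathRankFibre.avoid
          have : ¬ (I.vars j 2 = u ∨ I.vars j 3 = u) := fun h => hjt (mem_filter.2 ⟨hjD, h⟩)
          exact mem_filter.2 ⟨hjD, by simpa only [mem_singleton, not_or] using this⟩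
        exact budget_avoid j hja
  have hsum := card_bdry_le_sum I X q hq
  -- evaluate the sum: `X = {e} ⊔ through ⊔ avoid`
  have hXsplit : X = insert e (T ∪ avoid I D {u}) := by
    rw [hX]
    congr 1
    ext j
    unfold PstarPathRankFibre.avoid
    simp only [hT, mem_union, mem_filter, mem_singleton]
    constructor
    · intro hj
      by_cases h : I.vars j 2 = u ∨ I.vars j 3 = u
      · exact Or.inl ⟨hj, h⟩
      · push Not at h; exact Or.inr ⟨hj, h.1, h.2⟩
    · rintro (⟨hj, -⟩ | ⟨hj, -⟩) <;> exact hj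
  have hdisj : Disjoint (T) (avoid I D {u}) := by
    unfold PstarPathRankFibre.avoid
    rw [hT, disjoint_filter]
    intro j _ h
    simp only [mem_singleton, not_and, not_not]
    intro h2
    rcases h with h | h
    · exact absurd h h2
    · exact h
  have heTA : e ∉ T ∪ avoid I D {u} := by
    intro h
    rcases mem_union.1 h with h | h
    · exact heD (mem_filter.1 h).1
    · exact heD (mem_filter.1 h).1
  have hsum_eval : ∑ j ∈ X, q j = 2 + (T).card * (if (T).card = 1 then 2 else 1)
      + (avoid I D {u}).card * (if (avoid I D {u}).card = 1 then 2 else 1) := by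
    rw [hXsplit, sum_insert heTA, sum_union hdisj]
    have h1 : ∑ j ∈ T, q j = (T).card * (if (T).card = 1 then 2 else 1) := by
      rw [sum_congr rfl (fun j hj => ?_), sum_const, smul_eq_mul]
      have hje : j ≠ e := fun h => heD (h ▸ (mem_filter.1 hj).1)
      simp only [q, if_neg hje, if_pos hj]
    have h2 : ∑ j ∈ avoid I D {u}, q j = (avoid I D {u}).card * (if (avoid I D {u}).card = 1 then 2 else 1) := by
      rw [sum_congr rfl (fun j hj => ?_), sum_const, smul_eq_mul]
      have hje : j ≠ e := fun h => heD (h ▸ (mem_filter.1 hj).1)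
      have hjt : j ∉ T := fun h => disjoint_left.1 hdisj h hj
      simp only [q, if_neg hje, if_neg hjt]
    simp only [q, if_true]
    rw [h1, h2, add_assoc]
  rw [hsum_eval] at hsum
  -- arithmetic: with `#through ≥ 1`, `#avoid ≥ 1`, `#through + #avoid = #D ≥ 3`
  have ht1 : 1 ≤ (T).card := card_pos.2 ⟨jᵤ, hjᵤ⟩
  have ha1 : 1 ≤ (avoid I D {u}).card := card_pos.2 havne
  rw [hXcard]
  split_ifs at hsum with hc1 hc2 hc2 <;> omega

end Summit.PneNP.PneNP.Theorems.PstarGateFibreRank
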